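import Mathlib
import HarnessLib
import Summits.QuantumAdvantage.QuantumAdvantage.Theorems.DominoLawD

/-!
# The DOMINO LAW, part E: THE HITTING LAW — no fixed firing set wins on a non-zero low-degree set (lens 4 g26, node 4)

Part E.  §11 `eq_zero_of_fixedSet_wins` (every field with `2 ≠ 0`, `3 ≠ 0`; every `𝔽_p`, `p ≥ 5`): for `n > (12D + 6)(3D + 2)` the loss
set of every CONSTANT strategy (fixed firing set `Y`) meets the support of every non-zero function of degree `≤ D` — window scan: a
`Y`-free window of `3D + 2` interior cuts is the gap law (`GapLaw.gap_law`), else one `Y`-cut in every even window is the domino law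
(part D).  Corollaries `perfect_no_lowDeg_class` (a perfect strategy has no non-empty pattern class of `𝔽_p`-degree `≤ D`) and
`exists_loss_of_few_lowDeg_registers` (`|S|` registers of degree `≤ d` lose somewhere once `n > (12|S|d + 6)(3|S|d + 2)`).  The
characteristic-2 hitting law is the tree's `AdviceFreeQNC0/WalkFailSetHits.lean` (all strategy degrees, linear length); this is the
odd-characteristic, strategy-degree-0 counterpart.  NOT the residual `X = AbsorptionDial.NoPerfectPolyOdd`.  Supports
stmt-QuantumAdvantage-28487 (record).
-/

set_option autoImplicit false
set_option linter.dupNamespace false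

namespace Summit.QuantumAdvantage.QuantumAdvantage.Theorems.DominoLaw
open Classical
open Finset
open Summit.QuantumAdvantage.AdviceFreeQNC0
open Summit.QuantumAdvantage.AdviceFreeQNC0.JLinPeel
open Summit.QuantumAdvantage.QuantumAdvantage.Theorems.PhaseParity
open Summit.QuantumAdvantage.QuantumAdvantage.Theorems.GapLaw
open Literature.Computability.MetaComplexity Literature.Computability.MetaComplexity.Smolensky

section Hitting

variable {F : Type*} [Field F] {n : ℕ}

/-- **THE HITTING LAW (gap law ∨ domino law).**  Over a field with `2 ≠ 0` and `3 ≠ 0` (every `𝔽_p`, `p ≥ 5`;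
also `ℚ`), on every board with `n > (12D + 6)(3D + 2)`: a FIXED firing set `Y ⊆ [0, n]` wins at every point of
`{f ≠ 0}` for NO non-zero `f` of degree `≤ D`.  Equivalently: the loss set `{u : win_{Y,c}(u) = 0}` of every fixed firing
pattern meets the support of every non-zero function of degree `≤ D` — it is a hitting set for degree-`D` supports.
Proof: scan the `12D + 6` disjoint windows of `3D + 2` consecutive interior cuts; a `Y`-free window is a gap of length
`3D + 3` (gap law); otherwise one cut of `Y` in every even window gives `6D + 3` fired cuts pairwise `≥ 3D + 3 ≥ 3` apart
(domino law). -/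
theorem eq_zero_of_fixedSet_wins (h2 : (2 : F) ≠ 0) (h3 : (3 : F) ≠ 0) {D : ℕ}
    (hn : (12 * D + 6) * (3 * D + 2) + 1 ≤ n) (c : ℕ) (Y : Finset (Fin (n + 1))) {f : CubeFn F n}
    (hf : f ∈ lowDeg F n D) (hwin : ∀ u, f u ≠ 0 → winY c Y u = true) : f = 0 := by
  by_cases hA : ∃ i, i < 12 * D + 6 ∧ ∀ y ∈ Y, ¬ (i * (3 * D + 2) + 1 ≤ y.val ∧ y.val ≤ (i + 1) * (3 * D + 2))
  · -- a free window: the gap law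
    obtain ⟨i, hi, hfree⟩ := hA
    have hiL : (i + 1) * (3 * D + 2) ≤ (12 * D + 6) * (3 * D + 2) := Nat.mul_le_mul_right _ (by omega)
    have e : (i + 1) * (3 * D + 2) = i * (3 * D + 2) + (3 * D + 2) := by ring
    refine gap_law h3 (D := D) (a := i * (3 * D + 2)) (ℓ := 3 * D + 3) (by omega) (by omega) c Y
      (fun y hy => ?_) hf hwin
    have := hfree y hy
    omega
  · -- a cut in every window: the domino law on the even windows
    push Not at hA
    have hch : ∀ j : Fin (3 * (2 * D + 1)), ∃ y ∈ Y,
        2 * j.val * (3 * D + 2) + 1 ≤ y.val ∧ y.val ≤ (2 * j.val + 1) * (3 * D + 2) :=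
      fun j => hA (2 * j.val) (by have := j.isLt; omega)
    choose g hgY hg using hch
    have hsepg : ∀ j j' : Fin (3 * (2 * D + 1)), j < j' → (g j).val + 3 ≤ (g j').val := by
      intro j j' hjj
      have h1 := (hg j).2
      have h2 := (hg j').1
      have hjj' : j.val + 1 ≤ j'.val := Fin.lt_def.1 hjj
      have hm : (2 * j.val + 2) * (3 * D + 2) ≤ 2 * j'.val * (3 * D + 2) := Nat.mul_le_mul_right _ (by omega)
      have e : (2 * j.val + 2) * (3 * D + 2) = (2 * j.val + 1) * (3 * D + 2) + (3 * D + 2) := by ring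
      omega
    have hlo : ∀ j, 1 ≤ (g j).val := fun j => by have := (hg j).1; omega
    have hhi : ∀ j, (g j).val + 1 ≤ n := fun j => by
      have h1 := (hg j).2
      have hm : (2 * j.val + 1) * (3 * D + 2) ≤ (12 * D + 5) * (3 * D + 2) :=
        Nat.mul_le_mul_right _ (by have := j.isLt; omega)
      have e : (12 * D + 6) * (3 * D + 2) = (12 * D + 5) * (3 * D + 2) + (3 * D + 2) := by ring
      omega
    refine domino_law (K := 2 * D + 1) (fun j => (g j).val) hlo hhi hsepg h2 (le_refl _) c Y (fun j => ?_) hf hwin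
    have e : (⟨(g j).val, by have := hhi j; omega⟩ : Fin (n + 1)) = g j := Fin.ext rfl
    rw [e]
    exact hgY j

/-- **Corollary (perfect strategies have no low-degree pattern classes).**  For a prime `p ≥ 5` and a PERFECT strategy
`y` (it wins everywhere) on a board with `n > (12D + 6)(3D + 2)`: every Boolean function `P` of `𝔽_p`-degree `≤ D` on
whose level set `{P = 1}` the firing set of `y` is constant is identically `false`.  In particular every pattern class
of a perfect strategy supports no non-zero function of degree `≤ D` — the classes are equidistributed against all
degree-`D` tests (char `p`), although each class is cut out by the strategy's own polylog-degree features. -/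
theorem perfect_no_lowDeg_class (p : ℕ) [Fact p.Prime] (hp2 : p ≠ 2) (hp3 : p ≠ 3) {D : ℕ}
    (hn : (12 * D + 6) * (3 * D + 2) + 1 ≤ n) (c : ℕ) (y : Fin (n + 1) → (Fin n → Bool) → Bool)
    (hperf : ∀ u, ringWinU c y u = true) (P : (Fin n → Bool) → Bool) (hP : HasDegF p P D)
    (Y : Finset (Fin (n + 1))) (hfire : ∀ u, P u = true → ∀ g, (y g u = true ↔ g ∈ Y)) :
    ∀ u, P u = false := by
  have h2 : (2 : ZMod p) ≠ 0 := by
    intro h0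
    have h' : ((2 : ℕ) : ZMod p) = 0 := by exact_mod_cast h0
    rw [ZMod.natCast_eq_zero_iff] at h'
    exact hp2 ((Nat.prime_dvd_prime_iff_eq (Fact.out) Nat.prime_two).1 h')
  have h3 : (3 : ZMod p) ≠ 0 := three_ne_zero_zmod_of_ne p hp3
  have hwin : ∀ u, (fun x => if P x = true then (1 : ZMod p) else 0) u ≠ 0 → winY c Y u = true := by
    intro u hu
    have hPu : P u = true := by
      by_contra hc
      exact hu (by simp [hc])
    rw [← ringWinU_eq_winY c y Y u (hfire u hPu)]
    exact hperf u
  have hzero := eq_zero_of_fixedSet_wins h2 h3 hn c Y hP hwin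
  intro u
  have h0 := congr_fun hzero u
  by_contra hc
  rw [Bool.not_eq_false] at hc
  simp [hc] at h0

/-- **Corollary (sparse strategies lose).**  A strategy supported on a set `S` of cut registers, each of `𝔽_p`-degree `≤ d`
(`p ≥ 5`), loses somewhere as soon as `n > (12D + 6)(3D + 2)` with `D = |S|·d`: the common refinement of its firing
patterns has classes of degree `≤ |S| d`, and some class is non-empty. (The tree's sparse-shots law `walkHardFShots`
reaches `|S| d < n / polylog`; this is the fixed-pattern EXACT form with the quadratic board length.) -/
theorem exists_loss_of_few_lowDeg_registers (p : ℕ) [Fact p.Prime] (hp2 : p ≠ 2) (hp3 : p ≠ 3) {d : ℕ} (c : ℕ)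
    (y : Fin (n + 1) → (Fin n → Bool) → Bool) (S : Finset (Fin (n + 1)))
    (hsupp : ∀ g, g ∉ S → ∀ u, y g u = false) (hdeg : ∀ g, HasDegF p (y g) d)
    (hn : (12 * (S.card * d) + 6) * (3 * (S.card * d) + 2) + 1 ≤ n) : ∃ u, ringWinU c y u = false := by
  by_contra hno
  push Not at hno
  have hperf : ∀ u, ringWinU c y u = true := fun u => by
    have := hno u
    cases hru : ringWinU c y u
    · exact absurd hru this
    · rfl
  -- the pattern class of the origin `u₀ := 0`: `P u := ∏_{g ∈ S} [y g u = y g u₀]`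
  set u₀ : Fin n → Bool := fun _ => false with hu₀
  set Y : Finset (Fin (n + 1)) := S.filter fun g => y g u₀ = true with hY
  set P : (Fin n → Bool) → Bool := fun u => decide (∀ g ∈ S, y g u = y g u₀) with hPdef
  have hP : HasDegF p P (S.card * d) := by
    unfold HasDegF
    have e : (fun x => if P x = true then (1 : ZMod p) else 0) =
        ∏ g ∈ S, (fun x => if y g u₀ = true then (if y g x = true then (1 : ZMod p) else 0)
          else 1 - (if y g x = true then (1 : ZMod p) else 0)) := by
      funext x
      rw [Finset.prod_apply]
      by_cases hx : P x = true
      · rw [if_pos hx]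
        have hx' : ∀ g ∈ S, y g x = y g u₀ := by simpa [hPdef] using hx
        symm
        refine Finset.prod_eq_one fun g hg => ?_
        rw [hx' g hg]
        cases y g u₀ <;> simp
      · rw [if_neg hx]
        have hx' : ¬ ∀ g ∈ S, y g x = y g u₀ := by simpa [hPdef] using hx
        push Not at hx'
        obtain ⟨g, hg, hne⟩ := hx'
        symm
        refine Finset.prod_eq_zero hg ?_
        revert hne
        cases y g u₀ <;> cases y g x <;> simp
    rw [e]
    have hb : ∀ g ∈ S, (fun x => if y g u₀ = true then (if y g x = true then (1 : ZMod p) else 0)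
        else 1 - (if y g x = true then (1 : ZMod p) else 0)) ∈ lowDeg (ZMod p) n d := by
      intro g _
      cases y g u₀
      · have e1 : (fun x => if false = true then (if y g x = true then (1 : ZMod p) else 0)
            else 1 - (if y g x = true then (1 : ZMod p) else 0)) =
            1 - fun x => if y g x = true then (1 : ZMod p) else 0 := by
          funext x; simp
        rw [e1]
        exact Submodule.sub_mem _ (one_mem_lowDeg d) (hdeg g)
      · have e1 : (fun x => if true = true then (if y g x = true then (1 : ZMod p) else 0)
            else 1 - (if y g x = true then (1 : ZMod p) else 0)) =
            fun x => if y g x = true then (1 : ZMod p) else 0 := by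
          funext x; simp
        rw [e1]
        exact hdeg g
    exact prod_mem_lowDeg S hb
  have hfire : ∀ u, P u = true → ∀ g, (y g u = true ↔ g ∈ Y) := by
    intro u hu g
    have hu' : ∀ g ∈ S, y g u = y g u₀ := by simpa [hPdef] using hu
    rw [hY, Finset.mem_filter]
    constructor
    · intro hg
      have hgS : g ∈ S := by
        by_contra hn'
        rw [hsupp g hn' u] at hg
        exact Bool.false_ne_true hg
      exact ⟨hgS, by rw [← hu' g hgS]; exact hg⟩
    · rintro ⟨hgS, h0⟩
      rw [hu' g hgS]
      exact h0
  have hall := perfect_no_lowDeg_class p hp2 hp3 hn c y hperf P hP Y hfire u₀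
  have : P u₀ = true := by simp [hPdef]
  rw [hall] at this
  exact Bool.false_ne_true this

end Hitting

end Summit.QuantumAdvantage.QuantumAdvantage.Theorems.DominoLaw
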